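import Summits.BirchSwinnertonDyer.Rank1Residual.Additive.X3BranchDegenerateEndStateLayerTwoClassesT2
import Summits.BirchSwinnertonDyer.Rank1Residual.Additive.X3DegenerateDisplayKitLayerTwo
import HarnessLib

/-!
# X3, the DEGENERATE rows at `p = 3`, rank `0`, OFF the sub-locus, LAYER TWO ON BOTH SIDES: the DISPLAY KIT
# with the U-side over `ℚ_2 = ℚ(ζ₂₇)⁺` (integer `9`-vector tables, as `X3DegenerateDisplayKitLayerTwo.lean`)
# and the T-side over `ℚ_2` — twisted Kummer radicands in `ℤ[ζ₂₇]` as integer `18`-vector tables through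
# the multiplication table of `ℤ[ζ₂₇]` (`KummerLayerTwisted.zeta27_pow_mul_pow`, `zeta27_pow_eq_table`)
# (cell `bsd-eis`, seat `bsd-eis-x3` gen 8; feeds the end state
# `ClassX3Gord.bsdp_three_rankZero_degenerate_of_facts_of_torsionFact_of_layerTwoClassesT2`; route K1
# `AdditiveBranchIMC`, crux `GordTwoRankZeroOffCaseOne` — supports only)

HONEST FRAMING (`run/shared/lean/pub/bsd-eis/README.md` §4): THEOREMS ONLY; nothing is booked. A per-pair
display feeds `ClassX3Gord.bsdp_three_degenerate_display_layerTwoT2_of_record` with the 11 PUBLISHED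
records, ONE Cremona datum `hL`, ONE Q6 record `hrec` (instrument), and KERNEL data: class predicate, `Σ₀`,
good reduction, the `3`-torsion point, `T`, the tables of `θ₂` and of `ζ₂₇` (unified from the table
lemmas), the U-side unit tables (`decide`), the T-side tables `b, b', cb, t, t2, e3 ∈ ℤ^{kT×18}`,
`E ∈ ℤ^{kT×9}`, `Θ ∈ ℤ^{9×18}` (powers of `θ₂` on the basis `ζ^k`) with `decide`-able identities
(`b·b' = nT`, `cb = b(ζ²⁶)`, `t = E(θ₂)`, `t2 = t²`, `e3 = t³ = cb·b`), the `9×9` and `18×18`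
cubic-residue certificates, and `n + Σδ + 1 ≤ #T + kT + k`.
References: [GreenbergVatsal2000] §2 pp. 26–30; [MazurTateTeitelbaum1986Invent] §I.10, §I.13;
[Washington1997] §2, §13.1; [IrelandRosen1990] Ch. 9 §1.
-/

set_option autoImplicit false

noncomputable section

open scoped Classical AddSubgroup

namespace Summit.BirchSwinnertonDyer.Rank1Residual.Additive

open WeierstrassCurve NumberField IsDedekindDomain Field
  Literature.NumberTheory.EllipticCurves
  Literature.NumberTheory.EllipticCurves.ModularForms
  Literature.NumberTheory.EllipticCurves.GreenbergSelmer
  Literature.NumberTheory.EllipticCurves.GreenbergVatsal2000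
  Literature.NumberTheory.EllipticCurves.Rank1Residual
  Literature.NumberTheory.EllipticCurves.Rank1Residual.Typed
  Literature.NumberTheory.GaloisRepresentations
  Summit.BirchSwinnertonDyer.Rank1Residual.X1.MuLambda
  Summit.BirchSwinnertonDyer.Rank1Residual.AdditivePotMult
  Summit.BirchSwinnertonDyer.Rank1Residual.Additive.X3Branch


open X3DegenerateDisplayKitLayerArith X3DegenerateDisplayKitLayerT KummerLayerTwisted KummerLayerClasses in
/-- **`BSD₃(W)` on a DEGENERATE X3♯(G-ord) row of rank `0`, OFF the sub-locus, U-side AND T-side over `ℚ_2` —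
DISPLAY SHAPE in integer tables (NON-UNIT rows: ONE Q6 record `hrec`).** See the module docstring.
[cite: GreenbergVatsal2000, §2 pp. 26–30] [cite: MazurTateTeitelbaum1986Invent, §I.10 (10.1), §I.13]
[cite: Washington1997, §13.1] [cite: IrelandRosen1990, Ch. 9 §1] -/
theorem _root_.Summit.BirchSwinnertonDyer.Rank1Residual.Additive.ClassX3Gord.bsdp_three_degenerate_display_layerTwoT2_of_record
    [Fact (Nat.Prime 3)] {W : WeierstrassCurve ℚ} [W.IsElliptic] [W.IsGloballyMinimal]
    (hTors : Greenberg1999.finite_torsion_cyclotomicZpExtension)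
    (hDelG : Delbourgo1998.prop4_rankZero_constantCoeff_eq_unit_mul_of_potGoodOrd)
    (hDel98 : Delbourgo1998.prop4_rankZero_pow_dvd_constantCoeff)
    (hGZK : rank_eq_analyticRank_of_analyticRank_le_one) (hmod : hasEntireLFunction_rat)
    (hmodD : nonempty_modularParametrizationData)
    (hW16 : Wuthrich2014.thm16_halfEigenCharIdeal_dvd_cyclotomicPrime)
    (h23 : datumSelmer_nonPrimitive_invariants)
    (hRQ : datumSelmer_divisible_of_finite_torsionBy_of_gr_inertiaInvariants_eq_zero)
    (hGrK : Greenberg1999.imKummer_ge_strictCondition_goodOrdinary)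
    (hLiftE : residualEpsilon_surjOn_of_lineEven)
    (hX : ClassX3Gord W 3) {qL : ℚ} (hL : W.entireLFunction 1 = (qL : ℂ) * (W.realPeriodRat : ℂ))
    (hq0 : qL ≠ 0) {n : ℕ} (hrec : CensusQ6.GordOddFirstUnitIndexAt W 3 n)
    (S₀ : Finset (HeightOneSpectrum (𝓞 ℚ))) (hne : S₀.Nonempty)
    (hS₀ : ∀ v ∈ S₀, ((3 : ℕ) : 𝓞 ℚ) ∉ v.asIdeal)
    (hS : ∀ v : HeightOneSpectrum (𝓞 ℚ), v ∉ S₀ → ((3 : ℕ) : 𝓞 ℚ) ∉ v.asIdeal →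
      W.HasGoodReductionAt v)
    {x₀ y₀ : ℚ} (heq : y₀ ^ 2 + W.a₁ * x₀ * y₀ + W.a₃ * y₀ = x₀ ^ 3 + W.a₂ * x₀ ^ 2 + W.a₄ * x₀ + W.a₆)
    (hψ : W.Ψ₃.eval x₀ = 0) (hd : W.Ψ₂Sq.eval x₀ ≠ 0)
    (T : Finset ℕ) (hT : ∀ ℓ ∈ T, ℓ.Prime ∧ 3 ∣ ℓ - 1 ∧ ∃ v ∈ S₀, ((ℓ : ℕ) : 𝓞 ℚ) ∈ v.asIdeal)
    -- U-side over `ℚ_2`: the table of `θ₂` and unit tables (`9`-vectors)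
    {ζ : AlgebraicClosure ℚ} (hζ : IsPrimitiveRoot ζ 27) (μ : Fin 9 → Fin 9 → Fin 9 → ℤ)
    (hθtab : ∀ i j : Fin 9, (ζ + ζ ^ 26) ^ (i : ℕ) * (ζ + ζ ^ 26) ^ (j : ℕ) =
      ∑ kk : Fin 9, (μ kk i j : AlgebraicClosure ℚ) * (ζ + ζ ^ 26) ^ (kk : ℕ))
    {k : ℕ} (P B D D2 D3 Tc : Fin k → Fin 9 → ℤ) (nm : Fin k → ℕ) (hn0 : ∀ i, nm i ≠ 0)
    (hPB : ∀ i (kk : Fin 9), (∑ a, ∑ c, μ kk a c * P i a * B i c) = if kk = 0 then (nm i : ℤ) else 0)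
    (hD2 : ∀ i (kk : Fin 9), D2 i kk = ∑ a, ∑ c, μ kk a c * D i a * D i c)
    (hD3 : ∀ i (kk : Fin 9), D3 i kk = ∑ a, ∑ c, μ kk a c * D2 i a * D i c)
    (hPD3 : ∀ i (kk : Fin 9), (∑ a, ∑ c, μ kk a c * P i a * D3 i c) = (if kk = 0 then 1 else 0) + 9 * Tc i kk)
    (N₀ : ℕ) (hN₀ : ∀ v : HeightOneSpectrum (𝓞 ℚ), ((N₀ : ℕ) : 𝓞 ℚ) ∈ v.asIdeal → v ∈ S₀)
    (hnm : ∀ i, nm i ∣ N₀ ^ 64)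
    {R : ℕ} (q : Fin R → ℕ) (hq : ∀ ρ, (q ρ).Prime) (hq1 : ∀ ρ, 3 ∣ q ρ - 1)
    (r : (ρ : Fin R) → Fin 9 → ZMod (q ρ))
    (hrr : ∀ ρ kk, r ρ kk ^ 9 - 9 * r ρ kk ^ 7 + 27 * r ρ kk ^ 5 - 30 * r ρ kk ^ 3 + 9 * r ρ kk + 1 = 0)
    (w : (ρ : Fin R) → Fin 9 → Fin 9 → ZMod (q ρ))
    (hw : ∀ ρ (c c' : Fin 9), ∑ kk, w ρ c kk * r ρ kk ^ c'.val = if c = c' then 1 else 0)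
    (ω : (ρ : Fin R) → ZMod (q ρ)) (hω : ∀ ρ, ω ρ ^ 3 = 1 ∧ ω ρ ≠ 1)
    (e : Fin R → Fin k → ℕ)
    (he : ∀ ρ i, (∑ kk : Fin 9, (P i kk : ZMod (q ρ)) * r ρ 0 ^ (kk : ℕ)) ^ ((q ρ - 1) / 3) = ω ρ ^ e ρ i)
    (hnz : ∀ ρ i, (∑ kk : Fin 9, (P i kk : ZMod (q ρ)) * r ρ 0 ^ (kk : ℕ)) ≠ 0)
    (Linv : Fin k → Fin R → ℤ)
    (hLinv : ∀ i i', (∑ ρ, (Linv i ρ : ZMod 3) * (e ρ i' : ZMod 3)) = if i = i' then 1 else 0)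
    -- T-side over `ℚ_2`: the tables of `ℤ[ζ₂₇]`, powers of `θ₂` on the basis `ζ^k`, radicand tables (`18`-vectors)
    (μT : Fin 18 → Fin 18 → Fin 18 → ℤ)
    (hζtab : ∀ i j : Fin 18, ζ ^ (i : ℕ) * ζ ^ (j : ℕ) =
      ∑ kk : Fin 18, (μT kk i j : AlgebraicClosure ℚ) * ζ ^ (kk : ℕ))
    (νT : ℕ → Fin 18 → ℤ)
    (hζpow : ∀ m : ℕ, m ≤ 34 → ζ ^ m = ∑ kk : Fin 18, (νT m kk : AlgebraicClosure ℚ) * ζ ^ (kk : ℕ))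
    (Θ : Fin 9 → Fin 18 → ℤ) (hΘ0 : ∀ kk, Θ 0 kk = if kk = 0 then 1 else 0)
    (hΘs : ∀ (a : Fin 8) (kk : Fin 18),
      Θ a.succ kk = ∑ x, ∑ y, μT kk x y * Θ a.castSucc x * (νT 1 y + νT 26 y))
    {kT : ℕ} (b b' cb t t2 e3 : Fin kT → Fin 18 → ℤ) (E : Fin kT → Fin 9 → ℤ) (nT : Fin kT → ℕ)
    (hnT0 : ∀ j, nT j ≠ 0)
    (hNT : ∀ j (kk : Fin 18), (∑ a, ∑ c, μT kk a c * b j a * b' j c) = if kk = 0 then (nT j : ℤ) else 0)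
    (hcb : ∀ j (kk : Fin 18), cb j kk = ∑ a : Fin 18, νT (26 * (a : ℕ) % 27) kk * b j a)
    (ht : ∀ j (kk : Fin 18), t j kk = ∑ a : Fin 9, Θ a kk * E j a)
    (ht2 : ∀ j (kk : Fin 18), t2 j kk = ∑ a, ∑ c, μT kk a c * t j a * t j c)
    (he3 : ∀ j (kk : Fin 18), e3 j kk = ∑ a, ∑ c, μT kk a c * t2 j a * t j c)
    (hflip : ∀ j (kk : Fin 18), e3 j kk = ∑ a, ∑ c, μT kk a c * cb j a * b j c)
    (hnTd : ∀ j, nT j ∣ N₀ ^ 64) (hTn : ∀ ℓ ∈ T, ∀ j, ¬ ℓ ∣ nT j)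
    {R' : ℕ} (q' : Fin R' → ℕ) (hq' : ∀ ρ, (q' ρ).Prime) (hq81 : ∀ ρ, 81 ∣ q' ρ - 1)
    (r' : (ρ : Fin R') → Fin 18 → ZMod (q' ρ)) (hr' : ∀ ρ kk, r' ρ kk ^ 18 + r' ρ kk ^ 9 + 1 = 0)
    (w' : (ρ : Fin R') → Fin 18 → Fin 18 → ZMod (q' ρ))
    (hw' : ∀ ρ (a a' : Fin 18), ∑ kk, w' ρ a kk * r' ρ kk ^ a'.val = if a = a' then 1 else 0)
    (ω' : (ρ : Fin R') → ZMod (q' ρ)) (hω' : ∀ ρ, ω' ρ ^ 3 = 1 ∧ ω' ρ ≠ 1)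
    (e' : Fin R' → Fin kT → ℕ)
    (he' : ∀ ρ j, (∑ kk : Fin 18, (b j kk : ZMod (q' ρ)) * r' ρ 0 ^ (kk : ℕ)) ^ ((q' ρ - 1) / 3) =
      ω' ρ ^ e' ρ j)
    (hnz' : ∀ ρ j, (∑ kk : Fin 18, (b j kk : ZMod (q' ρ)) * r' ρ 0 ^ (kk : ℕ)) ≠ 0)
    (L' : Fin kT → Fin R' → ℤ)
    (hL' : ∀ j j', (∑ ρ, (L' j ρ : ZMod 3) * (e' ρ j' : ZMod 3)) = if j = j' then 1 else 0)
    (hcount : n + ∑ v ∈ S₀, delta W 3 v + 1 ≤ T.card + kT + k) :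
    BSDp W 3 := by
  set θ : AlgebraicClosure ℚ := ζ + ζ ^ 26 with hθdef
  -- `r_an = 0` from the non-vanishing `L`-value
  have hr : W.analyticRank = 0 := by
    refine (analyticRank_eq_zero_iff_holds (hmod _)).mpr ?_
    rw [hL]
    exact mul_ne_zero (by exact_mod_cast hq0) (by exact_mod_cast (realPeriodRat_pos_holds (W := W)).ne')
  obtain ⟨Φ₀, hΦ, htriv⟩ := X3DegenerateDisplayKit.exists_trivialLine_of_ratPoint heq hψ hd
  -- table products in `ℤ[θ₂]`
  have hprod : ∀ (x y : Fin 9 → ℤ), (∑ kk : Fin 9, (x kk : AlgebraicClosure ℚ) * θ ^ (kk : ℕ)) *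
      (∑ kk : Fin 9, (y kk : AlgebraicClosure ℚ) * θ ^ (kk : ℕ)) =
      ∑ kk : Fin 9, ((∑ a, ∑ c, μ kk a c * x a * y c : ℤ) : AlgebraicClosure ℚ) * θ ^ (kk : ℕ) := by
    intro x y
    rw [sum_mul_sum_eq_table μ θ hθtab]
    refine Finset.sum_congr rfl fun kk _ ↦ ?_
    push_cast; rfl
  -- table products in `ℤ[ζ₂₇]`
  have hprodζ : ∀ (x y : Fin 18 → ℤ), (∑ kk : Fin 18, (x kk : AlgebraicClosure ℚ) * ζ ^ (kk : ℕ)) *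
      (∑ kk : Fin 18, (y kk : AlgebraicClosure ℚ) * ζ ^ (kk : ℕ)) =
      ∑ kk : Fin 18, ((∑ a, ∑ c, μT kk a c * x a * y c : ℤ) : AlgebraicClosure ℚ) * ζ ^ (kk : ℕ) := by
    intro x y
    rw [sum_mul_sum_eq_table μT ζ hζtab]
    refine Finset.sum_congr rfl fun kk _ ↦ ?_
    push_cast; rfl
  -- `θ₂ = ζ + ζ²⁶` and its powers on the basis `ζ^k`
  have hθv : θ = ∑ y : Fin 18, ((νT 1 y + νT 26 y : ℤ) : AlgebraicClosure ℚ) * ζ ^ (y : ℕ) := by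
    rw [hθdef, show ζ + ζ ^ 26 = ζ ^ 1 + ζ ^ 26 by rw [pow_one], hζpow 1 (by norm_num),
      hζpow 26 (by norm_num), ← Finset.sum_add_distrib]
    refine Finset.sum_congr rfl fun y _ ↦ ?_
    push_cast; ring
  have hΘpow : ∀ a : Fin 9, θ ^ (a : ℕ) = ∑ kk : Fin 18, (Θ a kk : AlgebraicClosure ℚ) * ζ ^ (kk : ℕ) := by
    intro a
    induction a using Fin.induction with
    | zero =>
      rw [Fin.val_zero, pow_zero, Finset.sum_eq_single (0 : Fin 18)]
      · rw [hΘ0]; simp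
      · intro kk _ hkk; rw [hΘ0, if_neg hkk]; simp
      · intro h0; exact absurd (Finset.mem_univ _) h0
    | succ a ih =>
      rw [Fin.val_castSucc] at ih
      rw [Fin.val_succ, pow_succ, ih, hθv, hprodζ]
      refine Finset.sum_congr rfl fun kk _ ↦ ?_
      rw [hΘs a kk]
  have htE : ∀ j, (∑ a : Fin 9, (E j a : AlgebraicClosure ℚ) * θ ^ (a : ℕ)) =
      ∑ kk : Fin 18, (t j kk : AlgebraicClosure ℚ) * ζ ^ (kk : ℕ) := by
    intro j
    simp_rw [hΘpow, Finset.mul_sum]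
    rw [Finset.sum_comm]
    refine Finset.sum_congr rfl fun kk _ ↦ ?_
    rw [ht j kk]; push_cast
    rw [Finset.sum_mul]
    exact Finset.sum_congr rfl fun a _ ↦ by ring
  have hcbE : ∀ j, (∑ kk : Fin 18, (b j kk : AlgebraicClosure ℚ) * (ζ ^ 26) ^ (kk : ℕ)) =
      ∑ kk : Fin 18, (cb j kk : AlgebraicClosure ℚ) * ζ ^ (kk : ℕ) := by
    intro j
    have h26 : ∀ kk : Fin 18, (ζ ^ 26) ^ (kk : ℕ) =
        ∑ y : Fin 18, (νT (26 * (kk : ℕ) % 27) y : AlgebraicClosure ℚ) * ζ ^ (y : ℕ) := by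
      intro kk
      have hz : ζ ^ (26 * (kk : ℕ)) = ζ ^ (26 * (kk : ℕ) % 27) := by
        conv_lhs => rw [← Nat.mod_add_div (26 * (kk : ℕ)) 27, pow_add, pow_mul, hζ.pow_eq_one, one_pow,
          mul_one]
      rw [← pow_mul, hz]
      exact hζpow (26 * (kk : ℕ) % 27)
        (by have := Nat.mod_lt (26 * (kk : ℕ)) (show 0 < 27 by norm_num); omega)
    simp_rw [h26, Finset.mul_sum]
    rw [Finset.sum_comm]
    refine Finset.sum_congr rfl fun y _ ↦ ?_
    rw [hcb j y]; push_cast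
    rw [Finset.sum_mul]
    exact Finset.sum_congr rfl fun kk _ ↦ by ring
  refine ClassX3Gord.bsdp_three_rankZero_degenerate_of_facts_of_torsionFact_of_layerTwoClassesT2 hTors hDelG
    hDel98 hGZK hmod hmodD hW16 h23 hRQ hGrK hLiftE hX hr S₀ hne hS₀ hS Φ₀ hΦ htriv
    (ClassX3Gord.unitCoeffCert_three_of_gordOddFirstUnitIndex hX hrec) T hT hζ μ hθtab P B D Tc nm hn0
    ?_ ?_ ?_ q hq hq1 r hrr w hw ω hω e he hnz Linv hLinv b b' E nT hnT0 ?_ ?_ ?_ hTn q' hq' hq81 r' hr'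
    w' hw' ω' hω' e' he' hnz' L' hL' ?_
  · -- `a·b = nm`
    intro i
    rw [hprod, Finset.sum_eq_single (0 : Fin 9)]
    · rw [hPB]; simp
    · intro kk _ hkk; rw [hPB, if_neg hkk]; simp
    · intro h0; exact absurd (Finset.mem_univ _) h0
  · -- support of `nm`
    intro i v hv
    exact mem_of_natCast_mem_of_dvd_pow hN₀ (hnm i) v hv
  · -- the local cube `a·D³ = 1 + 9Tc`
    intro i
    have e2 : (∑ kk : Fin 9, (D i kk : AlgebraicClosure ℚ) * θ ^ (kk : ℕ)) ^ 2 =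
        ∑ kk : Fin 9, (D2 i kk : AlgebraicClosure ℚ) * θ ^ (kk : ℕ) := by
      rw [pow_two, hprod]
      exact Finset.sum_congr rfl fun kk _ ↦ by rw [← hD2]
    have e3 : (∑ kk : Fin 9, (D i kk : AlgebraicClosure ℚ) * θ ^ (kk : ℕ)) ^ 3 =
        ∑ kk : Fin 9, (D3 i kk : AlgebraicClosure ℚ) * θ ^ (kk : ℕ) := by
      rw [pow_succ, e2, hprod]
      exact Finset.sum_congr rfl fun kk _ ↦ by rw [← hD3]
    rw [e3, hprod]
    simp only [hPD3]
    rw [Fin.sum_univ_succ, Finset.mul_sum,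
      Fin.sum_univ_succ (fun kk : Fin 9 ↦ 9 * ((Tc i kk : AlgebraicClosure ℚ) * θ ^ (kk : ℕ)))]
    simp only [Fin.succ_ne_zero, ↓reduceIte, zero_add, Fin.val_zero, pow_zero, mul_one]
    push_cast
    rw [add_assoc]
    congr 2
    exact Finset.sum_congr rfl fun kk _ ↦ by ring
  · -- `b·b' = nT`
    intro j
    rw [hprodζ, Finset.sum_eq_single (0 : Fin 18)]
    · rw [hNT]; simp
    · intro kk _ hkk; rw [hNT, if_neg hkk]; simp
    · intro h0; exact absurd (Finset.mem_univ _) h0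
  · intro j v hv
    exact mem_of_natCast_mem_of_dvd_pow hN₀ (hnTd j) v hv
  · -- the flip relation `b(ζ²⁶)·b(ζ) = E(θ₂)³`
    intro j
    have e2 : (∑ kk : Fin 18, (t j kk : AlgebraicClosure ℚ) * ζ ^ (kk : ℕ)) ^ 2 =
        ∑ kk : Fin 18, (t2 j kk : AlgebraicClosure ℚ) * ζ ^ (kk : ℕ) := by
      rw [pow_two, hprodζ]
      exact Finset.sum_congr rfl fun kk _ ↦ by rw [← ht2]
    have e3' : (∑ kk : Fin 18, (t j kk : AlgebraicClosure ℚ) * ζ ^ (kk : ℕ)) ^ 3 =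
        ∑ kk : Fin 18, (e3 j kk : AlgebraicClosure ℚ) * ζ ^ (kk : ℕ) := by
      rw [pow_succ, e2, hprodζ]
      exact Finset.sum_congr rfl fun kk _ ↦ by rw [← he3]
    rw [hcbE, htE, e3', hprodζ]
    exact Finset.sum_congr rfl fun kk _ ↦ by rw [← hflip]
  · rwa [Fintype.card_fin, Fintype.card_fin]

end Summit.BirchSwinnertonDyer.Rank1Residual.Additive

end
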